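import Mathlib
import Summits.ResolutionOfSingularities.ResolutionOfSingularities.Theorems.WeightedInvariantLocalWeightedDropNCResRegimesOfBudgetEx
import Summits.ResolutionOfSingularities.ResolutionOfSingularities.Theorems.WeightedInvariantLocalWeightedDropNCResRegimeAssembly
import Summits.ResolutionOfSingularities.ResolutionOfSingularities.Theorems.WeightedInvariantLocalWeightedDropNCResCurveGraphClose
import Summits.ResolutionOfSingularities.ResolutionOfSingularities.Theorems.WeightedInvariantLocalWeightedDropNCResBadDir

/-!
# `LocalWeightedDrop`, TOT2-LINE inner S-ASM (13): THE DOOR `spaceNCRankDrop` — positional embedded normal-crossings resolution of surface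
# germs in a regular threefold germ, ordinal form — FROM THE CONFLICT BUDGET ALONE

Crux item stmt-ResolutionOfSingularities-8899 `WeightedInvariant.LocalWeightedDrop`, ENGINE skeleton v35 (2e806da509994632): the v32 stub
`stub_spaceNCRankDrop` (= res-L1-w43-strat-1's `stub_doorSpaceNCRankDrop` of the directrix-cut line v3f) is, since v33, the composition of the four
regime results through `TameFourTupleDrop.spaceNCRankDrop_of_regimes` (…NCResRegimeAssembly, res-L1-w43-stub-1's outer induction); with (H)
(res-L1-w43-stub-1 p545735) and (B) (res-type-056 p553762) closed and (P)/(L) reduced to the budget (…NCResRegimesOfBudgetEx), the door needs ONLY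
the registered budget stub `stub_conflictBudget`.  [OURS · L1 W4.3 · seat res-L1-w43-lead-1 gen 5 (registrar); def-free; a four-line composition.
Nothing here is a statement of any manuscript; AI-produced, gate-checked, weaker than expert review.]
-/

set_option linter.dupNamespace false -- mandated namespace of this single-conjunct summit

noncomputable section

namespace Summit.ResolutionOfSingularities.ResolutionOfSingularities.Theorems

namespace TameFourTupleDrop

open MvPowerSeries Literature.AlgebraicGeometry.Resolution PolyDescent

/-- **THE DOOR FROM THE BUDGET**: the statement of the v32 stub `stub_spaceNCRankDrop` (strat-1's `stub_doorSpaceNCRankDrop`) from the v35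
registered text of `stub_conflictBudget` as the only hypothesis. -/
theorem spaceNCRankDrop_of_budgetEx
    (hB : ∀ (p : ℕ), p.Prime → ∀ (k : Type) [Field k] [CharP k p] [IsAlgClosed k],
      ∃ M : (d : ℕ) → (Fin d → MvPowerSeries (Fin 2) k) → Finset (Fin 2) → ℕ,
        (∀ (d : ℕ) (A : Fin d → MvPowerSeries (Fin 2) k) (N : Finset (Fin 2)) (A' : Fin d → MvPowerSeries (Fin 2) k) (N' : Finset (Fin 2)),
          (∃ (b : MvPowerSeries (Fin 3) k) (δ : Decoration k 2) (Θ : Fin 3 → MvPowerSeries (Fin 3) k),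
            Admissible b δ ∧ 2 ≤ δ.o ∧ δ.c = d ∧ δ.PresBy d A N Θ) →
          InPoly d A → InPoly d A' → SuccFamilySel d (prepSelWP d) A N A' N' → M d A' N' ≤ M d A N) ∧
        (∀ (d : ℕ) (A : Fin d → MvPowerSeries (Fin 2) k) (N : Finset (Fin 2)) (A' : Fin d → MvPowerSeries (Fin 2) k) (N' : Finset (Fin 2)),
          (∃ (b : MvPowerSeries (Fin 3) k) (δ : Decoration k 2) (Θ : Fin 3 → MvPowerSeries (Fin 3) k),
            Admissible b δ ∧ 2 ≤ δ.o ∧ δ.c = d ∧ δ.PresBy d A N Θ) →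
          InPoly d A → InPoly d A' → NCPoly.Conflict d A N → PointFamilySel d (prepSelWP d) A N A' N' → M d A' N' < M d A N)) :
    ∀ (p : ℕ), p.Prime → ∀ (k : Type) [Field k] [CharP k p] [IsAlgClosed k],
      ∃ ρ : MvPowerSeries (Fin 3) k → Ordinal.{0}, ∀ b : MvPowerSeries (Fin 3) k, b ≠ 0 → ¬ GermIsNC b →
        ∃ (Φ : Fin 3 → MvPowerSeries (Fin 3) k) (w : Fin 3 → ℕ), IsCountMove (m := 2) Φ w ∧ MoveClause (m := 2) b Φ w (fun b' => ρ b' < ρ b) :=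
  spaceNCRankDrop_of_regimes stub_regimeApexColumn (stub_regimePresented_of_budgetEx hB) (stub_regimeLetter_of_budgetEx hB) NCResBad.regimeBad

end TameFourTupleDrop

end Summit.ResolutionOfSingularities.ResolutionOfSingularities.Theorems

end
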